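import Literature.AlgebraicGeometry.Frobenioids.ArchimedeanTheoremsInstances
import Mathlib.CategoryTheory.PEmpty
import HarnessLib

/-!
# Frobenioids II, Proposition 3.5 (iv) at `C` and `A`: the typed instances `Prop35iv_C π`, `Prop35iv_A π`
# (FACT-LIST F-0866 / F-0865) FAIL at the EMPTY base — their universal closure over all bases
# `π : D → D₀` is false; they hold under print's standing hypothesis "`D` connected, totally epimorphic"

Mochizuki, *The geometry of Frobenioids II: poly-Frobenioids*, Kyushu J. Math. **62** (2008) 401–460,
§3, Proposition 3.5 (iv), kurims p. 34: "`F` is not of RC-iso-subanchor type" (`F` one of the Frobenioids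
`C`, `A` of Example 3.3 over a base `D → D₀` of RC-iso-subanchor type), where Example 3.3 (i), p. 27,
opens with "Let `D` be a connected, totally epimorphic category" [cite: MochizukiFrdII2008, Prop 3.5 (iv) p.34].

Negative knowledge recorded next to `ArchimedeanTheoremsInstances.lean` (abc-iut-L1-t9), PROOF-ONLY (no
definition, no instance), abc-iut cell seat abc-iut-f-007 (block F, FACT-LIST rows **F-0866**
`ArchFrd.Prop35iv_C`, **F-0865** `ArchFrd.Prop35iv_A`; class `preparatory`, kernel_closedness
`parametrised` — the parameter is the base `π : D → D₀`).

`Prop35iv G F := RC.IsOfRCIsoSubanchorType G → ¬ RC.IsOfRCIsoSubanchorType (baseFunctor F ⋙ G)`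
(`ArchimedeanIsoSubanchors.lean`), instantiated at `G := baseRC π`, `F := C.toElem π` resp. `A.toElem π`.
"Of RC-iso-subanchor type" is "EVERY object is an RC-iso-subanchor" ([FrdII] Def. 3.1 (v),
`RC.IsOfRCIsoSubanchorType`), which is VACUOUS on an empty category.  Over the EMPTY base `D = ∅`
(`π := Functor.empty D₀`) the categories `C π = C₀ ×_{D₀} ∅` and `A π ⊆ C π` are empty as well, so both
sides of the implication are vacuously of RC-iso-subanchor type and `Prop35iv_C π`, `Prop35iv_A π` read
`True → ¬ True`:

* `not_prop35iv_C_empty`, `not_prop35iv_A_empty` — the named instances at `D = ∅`;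
* `not_forall_prop35iv_C`, `not_forall_prop35iv_A` — the closures `∀ D π, Prop35iv_C π` /
  `∀ D π, Prop35iv_A π` (at universe level `0`) are FALSE.

The typed instances do not bind print's standing hypothesis "`D` connected [totally epimorphic]"
(Ex. 3.3 (i)); WITH it they are PROVED in the tree: `ArchFrd.prop35iv_C (hD : IsGraphConnected D)
(hTE : IsTotallyEpimorphic D)` (`ArchimedeanNotIsoSubanchorC.lean`), `ArchFrd.prop35iv_A (hD) (hTE)`
(`ArchimedeanNotIsoSubanchorAngular.lean`), unconditionally at the IUT archimedean place
`ArchFrd.prop35iv_C_ptBase` / `ArchFrd.prop35iv_A_ptBase` (`ArchimedeanPointBaseProp35.lean`), and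
modulo "`C`/`A` is a Frobenioid" over any nonempty base `ArchFrd.prop35iv_C_of_isFrobenioid` /
`prop35iv_A_of_isFrobenioid` (`ArchimedeanNotIsoSubanchor.lean`).  So each row is admissible ONLY as
those instance theorems (FACT-LIST class «universal-closure REFUTED; instance form PROVED under the
printed standing hypothesis»).  This is a remark about OUR typing (a missing `Nonempty D` /
connectedness binder), not about the paper; nothing here bears on the disputed [IUTchIII] Cor. 3.12 or
takes a side.
-/

namespace Literature.AlgebraicGeometry.Frobenioids

namespace ArchFrd

open CategoryTheory

/-- An empty category is (vacuously) of RC-iso-subanchor type over `D₀`, whatever the functor.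
[cite: MochizukiFrdII2008, Def 3.1 (v) p.25] -/
theorem isOfRCIsoSubanchorType_of_isEmpty {𝓕 : Type*} [Category 𝓕] [IsEmpty 𝓕]
    (P : 𝓕 ⥤ ArchBase) : RC.IsOfRCIsoSubanchorType P :=
  ⟨fun A => isEmptyElim A⟩

/-- Over the empty base, the archimedean Frobenioid `C = C₀ ×_{D₀} ∅` has no objects.
[cite: MochizukiFrdII2008, Ex 3.3 (i) p.27] -/
theorem C.isEmpty_of_empty : IsEmpty (C (Functor.empty D0 : Discrete PEmpty.{1} ⥤ D0)) :=
  ⟨fun X => X.snd.as.elim⟩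

/-- Over the empty base, the angular Frobenioid `A ⊆ C` has no objects.
[cite: MochizukiFrdII2008, Ex 3.3 (iii) p.28] -/
theorem A.isEmpty_of_empty : IsEmpty (A (Functor.empty D0 : Discrete PEmpty.{1} ⥤ D0)) :=
  ⟨fun X => X.obj.snd.as.elim⟩

/-! ### F-0866: `Prop35iv_C` -/

/-- **F-0866 fails at the empty base:** `¬ Prop35iv_C (∅ → D₀)` — both `D = ∅` and `C = ∅` are
vacuously of RC-iso-subanchor type. [cite: MochizukiFrdII2008, Prop 3.5 (iv) p.34] -/
theorem not_prop35iv_C_empty : ¬ Prop35iv_C (Functor.empty D0 : Discrete PEmpty.{1} ⥤ D0) := by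
  intro h
  haveI := C.isEmpty_of_empty
  exact h (isOfRCIsoSubanchorType_of_isEmpty _) (isOfRCIsoSubanchorType_of_isEmpty _)

/-- **F-0866 as typed is not a fact over ALL bases:** the closure `∀ D π, Prop35iv_C π` (universe
level `0`) is FALSE; the instance holds under print's "`D` connected, totally epimorphic"
(`ArchFrd.prop35iv_C`) and at the IUT place (`ArchFrd.prop35iv_C_ptBase`).
[cite: MochizukiFrdII2008, Prop 3.5 (iv) p.34] -/
theorem not_forall_prop35iv_C :
    ¬ ∀ {D : Type} [Category.{0} D] (π : D ⥤ D0), Prop35iv_C π :=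
  fun h => not_prop35iv_C_empty (h _)

/-! ### F-0865: `Prop35iv_A` -/

/-- **F-0865 fails at the empty base:** `¬ Prop35iv_A (∅ → D₀)` — both `D = ∅` and `A = ∅` are
vacuously of RC-iso-subanchor type. [cite: MochizukiFrdII2008, Prop 3.5 (iv) p.34] -/
theorem not_prop35iv_A_empty : ¬ Prop35iv_A (Functor.empty D0 : Discrete PEmpty.{1} ⥤ D0) := by
  intro h
  haveI := A.isEmpty_of_empty
  exact h (isOfRCIsoSubanchorType_of_isEmpty _) (isOfRCIsoSubanchorType_of_isEmpty _)

/-- **F-0865 as typed is not a fact over ALL bases:** the closure `∀ D π, Prop35iv_A π` (universe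
level `0`) is FALSE; the instance holds under print's "`D` connected, totally epimorphic"
(`ArchFrd.prop35iv_A`) and at the IUT place (`ArchFrd.prop35iv_A_ptBase`).
[cite: MochizukiFrdII2008, Prop 3.5 (iv) p.34] -/
theorem not_forall_prop35iv_A :
    ¬ ∀ {D : Type} [Category.{0} D] (π : D ⥤ D0), Prop35iv_A π :=
  fun h => not_prop35iv_A_empty (h _)

end ArchFrd

end Literature.AlgebraicGeometry.Frobenioids
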